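/-
Copyright (c) 2026 the pub-hodgecm-mathlib formalisation cell (harness21).  Prover seat hodgecm-mathlib-K2Liu-p13 (g2), Track B «K2-LIT»,
#184♮ = hLiu418 = `stmt-HodgeConjecture-24832`; Road I v3 organ U1-CT-ind STAGE 2 (Q2), file F12 — ★ F5-c's Klingen-Levi law with the modulus EXPLICIT (`δ = ‖a‖²‖b₀₀‖⁻¹`).
-/
import Summits.HodgeConjecture.HodgeConjecture.Theorems.K2LiuKlingenInnerSectionBorelInvariant   -- ★ F5-p (+ ★ F5-n `klingenInner_hscale`, ★ F5-o `map_mul_right_eq_ideleNorm_smul`, ★ F5-c the law)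
import Summits.HodgeConjecture.HodgeConjecture.Theorems.K2LiuSkewLineModulus                    -- ★ F11: `map_scaleY_eq_ideleNorm_smul` (`D_Y = ‖a‖`) on `traceZeroAdele`
import HarnessLib

/-!
# Crux `HLiu418`, Road I v3, organ U1 stage 2 (Q2), file F12: THE KLINGEN-LEVI LAW OF THE INNER SECTION WITH EXPLICIT MODULUS —
# `F(Ψ(m_Q(a,b))·x) = χ_s(Ψ(ξ m_Q(a,b) ξ⁻¹)) · ‖a‖_{𝔸_L}·‖a·u⁻¹‖_{𝔸_L} · F(x)` (`u = b₀₀`), on `Y := traceZeroAdele L⁺ L c`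

Cell `hodgecm-mathlib`, crux item hLiu418 = `stmt-HodgeConjecture-24832`; squad K2 ∕ K2Liu; LEAD F0P6-plan (g14), co-dealer K2E5-plan (g7); prover K2Liu-p13 (g2).
THEOREMS ONLY (no `def`, no instance, no notation, no named-fact hypothesis, no `sorry`); lane `--supports stmt-HodgeConjecture-24832 --as helper` (count-neutral).
★ F5-c's `klingenInner_levi_law` took the substitution modulus `δ` BY VALUE; ★ F5-n reduced it to two scalar moduli `D_Y`, `D_T`; ★ F5-o computed `D_T = ‖(a⁻¹u)⁻¹‖_{𝔸_L}` and ★ F11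
computed `D_Y = ‖a‖_{𝔸_L}` on the tree's skew line `traceZeroAdele L⁺ L c` (★ `UnitaryGroupGlobalGenericity`).  HERE the assembly, for ALL `a ∈ 𝔸_L^×` and ALL upper-triangular
`b ∈ U(J₂)(𝔸)` with `b₀₀ = u`: **`klingenInner_levi_law_explicit`** — the Klingen-Levi law of `F(x) = ∫ f(Ψ(ξ)·Ψ(n_Q(y,0,t))·x) d(μ_Y × μ_T)` with the factor
`siegelDeltaCharacter χ s (Ψ(ξ m_Q(a,b) ξ⁻¹)) · ‖a‖_{𝔸_L} · ‖(a⁻¹u)⁻¹‖_{𝔸_L}`, binder-free up to the Haar∕regularity instances of `μ_Y`, `μ_T`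
(`det_Δ(Ψ(ξ m ξ⁻¹)) = u·σ(a)⁻¹`, ★ F5-c: the character is `χ(uσ(a)⁻¹)‖uσ(a)⁻¹‖^{s+1}`; total `a`-exponent `‖a‖^{2−(s+1)}·` — the cuspidal exponent of term 2).
[MoeglinWaldspurger1995, II.1.7], [GanTakeda2011SiegelWeil, §7.2 p. 23], [WeilBNT1967, Ch. IV §3], [CasselsFrohlichANT1967, Ch. XV Lemma 4.1.2].
HONEST LABEL.  Count-neutral helper: `HC_CM` is proved only modulo the 7 printed citations (2 remaining named inputs: hLiu418 = `stmt-HodgeConjecture-24832`,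
h413 = `stmt-HodgeConjecture-24833`) until rung 0 closes.
-/

set_option autoImplicit false
set_option linter.dupNamespace false -- the mandated namespace repeats `HodgeConjecture.HodgeConjecture`

noncomputable section

open scoped Matrix ENNReal NNReal
open NumberField IsDedekindDomain MeasureTheory MeasureTheory.Measure

namespace Summit.HodgeConjecture.HodgeConjecture.Cruxes.HLiu418.K2LiuKlingenInnerSectionLeviLawExplicit

open Literature.NumberTheory.Automorphic Literature.NumberTheory.Automorphic.UnitaryGroup
open Literature.NumberTheory.GelbartRogawski1991 Literature.NumberTheory.GelbartRogawski1991.GRConstruction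
open Literature.NumberTheory.GaloisRepresentations
open Literature.NumberTheory.K2Lit.SiegelDoubled
open Summit.HodgeConjecture.HodgeConjecture.Cruxes.HLiu418.K2LiuDoubledUTwoTwoBorelFrame
open Summit.HodgeConjecture.HodgeConjecture.Cruxes.HLiu418.K2LiuKlingenParabolicDefs
open Summit.HodgeConjecture.HodgeConjecture.Cruxes.HLiu418.K2LiuKlingenUnipotentDefs
open Summit.HodgeConjecture.HodgeConjecture.Cruxes.HLiu418.K2LiuKlingenUnipotentAdelicDefs
open Summit.HodgeConjecture.HodgeConjecture.Cruxes.HLiu418.K2LiuKlingenInnerSectionLeviLaw (klingenInner_levi_law)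
open Summit.HodgeConjecture.HodgeConjecture.Cruxes.HLiu418.K2LiuKlingenInnerSectionModulus (klingenInner_hscale fst_klingenSubst snd_klingenSubst skew_unit_mul)
open Summit.HodgeConjecture.HodgeConjecture.Cruxes.HLiu418.K2LiuAdelicScalarModulus (map_mul_right_eq_ideleNorm_smul)
open Summit.HodgeConjecture.HodgeConjecture.Cruxes.HLiu418.K2LiuSkewLineModulus (map_scaleY_eq_ideleNorm_smul)
open Summit.HodgeConjecture.HodgeConjecture.Cruxes.HLiu418.K2LiuSiegelDoubledLeviMatrix (conjAdele_conjAdele')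
open UnitaryDualPair

variable {L : Type} [Field L] [NumberField L] [IsCMField L]
variable {N M : ℕ} {e : Fin N × Fin M ≃ Fin 2}
  {dV : Fin N → L} {hdV : ∀ i, IsCMField.complexConj L (dV i) = dV i}
  {dW : Fin M → L} {hdW : ∀ i, IsCMField.complexConj L (dW i) = dW i}

section Transport

variable {SA : GL (Fin (2 + 2)) (AdeleRing (𝓞 L) L)}
  {Ψ : (quasiSplit (Fp L) L (IsCMField.complexConj L) (2 + 2)).Adelic ≃ₜ* HA L e dV hdV dW hdW} {X Y : Matrix (Fin 2) (Fin 2) (Fp L)} {a : Fp L}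
  (hΨ : ∀ g : (quasiSplit (Fp L) L (IsCMField.complexConj L) (2 + 2)).Adelic,
    (((Ψ g : HA L e dV hdV dW hdW) : GL (Fin (2 + 2)) (AdeleRing (𝓞 L) L)) : Matrix (Fin (2 + 2)) (Fin (2 + 2)) (AdeleRing (𝓞 L) L)) =
      (SA : Matrix (Fin (2 + 2)) (Fin (2 + 2)) (AdeleRing (𝓞 L) L)) *
        ((adelicVal (Fp L) L (IsCMField.complexConj L) (2 + 2) _ g : GL (Fin (2 + 2)) (AdeleRing (𝓞 L) L)) :
          Matrix (Fin (2 + 2)) (Fin (2 + 2)) (AdeleRing (𝓞 L) L)) *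
        ((SA⁻¹ : GL (Fin (2 + 2)) (AdeleRing (𝓞 L) L)) : Matrix (Fin (2 + 2)) (Fin (2 + 2)) (AdeleRing (𝓞 L) L)))
  (ha : a + a = 1)
  (hSA : Matrix.reindex (e₂ (n := 2)).symm (e₂ (n := 2)).symm (SA : Matrix (Fin (2 + 2)) (Fin (2 + 2)) (AdeleRing (𝓞 L) L)) =
    Matrix.fromBlocks (1 : Matrix (Fin 2) (Fin 2) (AdeleRing (𝓞 L) L)) (X.map ((algebraMap L (AdeleRing (𝓞 L) L)).comp (algebraMap (Fp L) L))) 1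
      (-(X.map ((algebraMap L (AdeleRing (𝓞 L) L)).comp (algebraMap (Fp L) L)))))
  (hSAi : Matrix.reindex (e₂ (n := 2)).symm (e₂ (n := 2)).symm ((SA⁻¹ : GL (Fin (2 + 2)) (AdeleRing (𝓞 L) L)) : Matrix (Fin (2 + 2)) (Fin (2 + 2)) (AdeleRing (𝓞 L) L)) =
    Matrix.fromBlocks ((a • (1 : Matrix (Fin 2) (Fin 2) (Fp L))).map ((algebraMap L (AdeleRing (𝓞 L) L)).comp (algebraMap (Fp L) L)))
      ((a • (1 : Matrix (Fin 2) (Fin 2) (Fp L))).map ((algebraMap L (AdeleRing (𝓞 L) L)).comp (algebraMap (Fp L) L)))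
      (Y.map ((algebraMap L (AdeleRing (𝓞 L) L)).comp (algebraMap (Fp L) L)))
      (-(Y.map ((algebraMap L (AdeleRing (𝓞 L) L)).comp (algebraMap (Fp L) L)))))
  (hΨP : ∀ b : (quasiSplit (Fp L) L (IsCMField.complexConj L) (2 + 2)).Adelic,
    ((adelicVal (Fp L) L (IsCMField.complexConj L) (2 + 2) _ b : GL (Fin (2 + 2)) (AdeleRing (𝓞 L) L)) :
        Matrix (Fin (2 + 2)) (Fin (2 + 2)) (AdeleRing (𝓞 L) L)).BlockTriangular id →
      IsSiegelDelta L e dV hdV dW hdW (Ψ b))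

/-- **`D_T` for the Klingen substitution**: `(t ↦ a⁻¹·t·b₀₀)_*μ_T = ‖(a⁻¹u)⁻¹‖_{𝔸_L}·μ_T` when `b₀₀ = u` (★ F5-o). [cite: WeilBNT1967, Ch. IV §3 Cor. 1] -/
theorem map_scaleT_eq [MeasurableSpace (AdeleRing (𝓞 L) L)] [BorelSpace (AdeleRing (𝓞 L) L)] (μT : Measure (AdeleRing (𝓞 L) L)) [μT.IsAddHaarMeasure]
    (a' : (AdeleRing (𝓞 L) L)ˣ) {b : unitaryGroupOfForm (conjAdele (Fp L) L (IsCMField.complexConj L)) ((StdForm.antidiagonal 2).over (AdeleRing (𝓞 L) L))} (u : (AdeleRing (𝓞 L) L)ˣ) (hu : (u : AdeleRing (𝓞 L) L) = ((b : GL (Fin 2) (AdeleRing (𝓞 L) L)) : Matrix (Fin 2) (Fin 2) (AdeleRing (𝓞 L) L)) 0 0) :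
    μT.map (fun t : AdeleRing (𝓞 L) L => ((a'⁻¹ : (AdeleRing (𝓞 L) L)ˣ) : AdeleRing (𝓞 L) L) * t * ((b : GL (Fin 2) (AdeleRing (𝓞 L) L)) : Matrix (Fin 2) (Fin 2) (AdeleRing (𝓞 L) L)) 0 0) = ((IdeleClassGroup.ideleNorm L (a'⁻¹ * u)⁻¹ : ℝ≥0) : ℝ≥0∞) • μT := by
  have hfun : (fun t : AdeleRing (𝓞 L) L => ((a'⁻¹ : (AdeleRing (𝓞 L) L)ˣ) : AdeleRing (𝓞 L) L) * t * ((b : GL (Fin 2) (AdeleRing (𝓞 L) L)) : Matrix (Fin 2) (Fin 2) (AdeleRing (𝓞 L) L)) 0 0) = fun t => t * ((a'⁻¹ * u : (AdeleRing (𝓞 L) L)ˣ) : AdeleRing (𝓞 L) L) := by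
    funext t; rw [Units.val_mul, ← hu]; ring
  rw [hfun, map_mul_right_eq_ideleNorm_smul μT (a'⁻¹ * u)]

include hΨ ha hSA hSAi hΨP in
/-- **(Q2) F12 — THE KLINGEN-LEVI LAW WITH EXPLICIT MODULUS.**  `Y := traceZeroAdele L⁺ L c`, `μ_Y` a regular additive Haar measure on it, `μ_T` an additive Haar measure on `𝔸_L`
(s-finite), `f` a continuous Siegel section of `I_Δ(s,χ)`, `a ∈ 𝔸_L^×`, `b ∈ U(J₂)(𝔸)` upper triangular with `b₀₀ = u ∈ 𝔸_L^×`; THEN for every `x ∈ H(𝔸)`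
  `F(Ψ(jAdelic m_Q(a,b)) · x) = siegelDeltaCharacter χ s (Ψ(jAdelic (ξ m_Q(a,b) ξ⁻¹))) · (‖a‖_{𝔸_L}·‖(a⁻¹u)⁻¹‖_{𝔸_L}) · F(x)`,
`F(x) = ∫ f(Ψ(ξ)·Ψ(n_Q(q.1, 0, q.2))·x) d(μ_Y × μ_T)` (★ F5-c law + ★ F5-n substitution + ★ F11 `D_Y = ‖a‖` + ★ F5-o `D_T`).
[cite: MoeglinWaldspurger1995, II.1.7] [cite: GanTakeda2011SiegelWeil, §7.2 p. 23] [cite: WeilBNT1967, Ch. IV §3] -/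
theorem klingenInner_levi_law_explicit [MeasurableSpace (AdeleRing (𝓞 L) L)] [BorelSpace (AdeleRing (𝓞 L) L)] [SecondCountableTopology (AdeleRing (𝓞 L) L)]
    (μY : Measure ↥(traceZeroAdele (Fp L) L (IsCMField.complexConj L))) (μT : Measure (AdeleRing (𝓞 L) L)) [SFinite μY] [SFinite μT] [μY.IsAddHaarMeasure] [μY.Regular] [μT.IsAddHaarMeasure]
    {χ : HeckeCharacter L} {s : ℂ} {f : HA L e dV hdV dW hdW → ℂ} (hf : IsSiegelDeltaSection L e dV hdV dW hdW χ s f) (hfc : Continuous f)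
    (a' : (AdeleRing (𝓞 L) L)ˣ) {b : unitaryGroupOfForm (conjAdele (Fp L) L (IsCMField.complexConj L)) ((StdForm.antidiagonal 2).over (AdeleRing (𝓞 L) L))} (hb : ((b : GL (Fin 2) (AdeleRing (𝓞 L) L)) : Matrix (Fin 2) (Fin 2) (AdeleRing (𝓞 L) L)) 1 0 = 0)
    (u : (AdeleRing (𝓞 L) L)ˣ) (hu : (u : AdeleRing (𝓞 L) L) = ((b : GL (Fin 2) (AdeleRing (𝓞 L) L)) : Matrix (Fin 2) (Fin 2) (AdeleRing (𝓞 L) L)) 0 0) (x : HA L e dV hdV dW hdW) :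
    (∫ q : ↥(traceZeroAdele (Fp L) L (IsCMField.complexConj L)) × AdeleRing (𝓞 L) L, f (Ψ (jAdelic L 4 (weylXi (AdeleRing (𝓞 L) L) (conjAdele (Fp L) L (IsCMField.complexConj L)))) * Ψ (jAdelic L 4 (nKlingen (AdeleRing (𝓞 L) L) (conjAdele (Fp L) L (IsCMField.complexConj L)) (conjAdele_conjAdele' L) (((q.1 : ↥(traceZeroAdele (Fp L) L (IsCMField.complexConj L))) : AdeleRing (𝓞 L) L)) ((mem_traceZeroAdele_iff _).1 q.1.2) 0 (q.2))) * (Ψ (jAdelic L 4 (klingenLevi (AdeleRing (𝓞 L) L) (conjAdele (Fp L) L (IsCMField.complexConj L)) (conjAdele_conjAdele' L) a' b)) * x)) ∂(μY.prod μT)) =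
      siegelDeltaCharacter L e dV hdV dW hdW χ s (Ψ (jAdelic L 4 ((weylXi (AdeleRing (𝓞 L) L) (conjAdele (Fp L) L (IsCMField.complexConj L))) * klingenLevi (AdeleRing (𝓞 L) L) (conjAdele (Fp L) L (IsCMField.complexConj L)) (conjAdele_conjAdele' L) a' b * (weylXi (AdeleRing (𝓞 L) L) (conjAdele (Fp L) L (IsCMField.complexConj L)))⁻¹))) *
        ((IdeleClassGroup.ideleNorm L a' * IdeleClassGroup.ideleNorm L (a'⁻¹ * u)⁻¹ : ℝ≥0) : ℂ) * (∫ q : ↥(traceZeroAdele (Fp L) L (IsCMField.complexConj L)) × AdeleRing (𝓞 L) L, f (Ψ (jAdelic L 4 (weylXi (AdeleRing (𝓞 L) L) (conjAdele (Fp L) L (IsCMField.complexConj L)))) * Ψ (jAdelic L 4 (nKlingen (AdeleRing (𝓞 L) L) (conjAdele (Fp L) L (IsCMField.complexConj L)) (conjAdele_conjAdele' L) (((q.1 : ↥(traceZeroAdele (Fp L) L (IsCMField.complexConj L))) : AdeleRing (𝓞 L) L)) ((mem_traceZeroAdele_iff _).1 q.1.2) 0 (q.2))) * (x)) ∂(μY.prod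 μT)) := by
  have hYs := map_scaleY_eq_ideleNorm_smul μY a'
    (fun y => (mem_traceZeroAdele_iff _).2 (skew_unit_mul (conjAdele_conjAdele' L) a' ((mem_traceZeroAdele_iff _).1 y.2)))
  have hlaw := klingenInner_levi_law hΨ ha hSA hSAi hΨP (μY.prod μT) (fun q : ↥(traceZeroAdele (Fp L) L (IsCMField.complexConj L)) × AdeleRing (𝓞 L) L => ((q.1 : ↥(traceZeroAdele (Fp L) L (IsCMField.complexConj L))) : AdeleRing (𝓞 L) L))
    (fun q => (mem_traceZeroAdele_iff _).1 q.1.2) (fun q : ↥(traceZeroAdele (Fp L) L (IsCMField.complexConj L)) × AdeleRing (𝓞 L) L => q.2) a' hb _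
    (fst_klingenSubst (traceZeroAdele (Fp L) L (IsCMField.complexConj L)) (fun y => mem_traceZeroAdele_iff y) a' hb) (snd_klingenSubst (traceZeroAdele (Fp L) L (IsCMField.complexConj L)) (fun y => mem_traceZeroAdele_iff y) a' hb) hf
    (fun x' => (∫ q : ↥(traceZeroAdele (Fp L) L (IsCMField.complexConj L)) × AdeleRing (𝓞 L) L, f (Ψ (jAdelic L 4 (weylXi (AdeleRing (𝓞 L) L) (conjAdele (Fp L) L (IsCMField.complexConj L)))) * Ψ (jAdelic L 4 (nKlingen (AdeleRing (𝓞 L) L) (conjAdele (Fp L) L (IsCMField.complexConj L)) (conjAdele_conjAdele' L) (((q.1 : ↥(traceZeroAdele (Fp L) L (IsCMField.complexConj L))) : AdeleRing (𝓞 L) L)) ((mem_traceZeroAdele_iff _).1 q.1.2) 0 (q.2))) * (x')) ∂(μY.prod μT))) (fun x' => rfl) _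
    (klingenInner_hscale hΨ (traceZeroAdele (Fp L) L (IsCMField.complexConj L)) (fun y => mem_traceZeroAdele_iff y) μY μT a' hb hYs (map_scaleT_eq μT a' u hu) hfc) x
  rw [hlaw, ← ENNReal.coe_mul, ENNReal.coe_toReal]

end Transport

end Summit.HodgeConjecture.HodgeConjecture.Cruxes.HLiu418.K2LiuKlingenInnerSectionLeviLawExplicit

end
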